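import Literature.NumberTheory.EllipticCurves.NewformsOldNewProofs
import Literature.NumberTheory.EllipticCurves.NewformsMainLemmaTraceProofs
import HarnessLib

/-!
# Strong multiplicity one on `Γ₀(N)` (same level), proved
# (trunk EllArithM; discharge of `IsNewform0.eq_of_heckeEigenvalue_eq` of `Newforms.lean`)

`Newforms.lean` states as a named fact (D-0014)

  `IsNewform0.eq_of_heckeEigenvalue_eq : ∀ {f g : S_k(Γ₀(N))}, IsNewform0 f → IsNewform0 g →
    {p prime | λ_f(p) ≠ λ_g(p)}.Finite → f = g`,

**strong multiplicity one** in the same-level case (Atkin–Lehner, *Hecke operators on `Γ₀(m)`*,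
Math. Ann. 185 (1970), Thm. 4; Diamond–Shurman, *A first course in modular forms*, p. 219: "We do
not prove Strong Multiplicity One"; Rankin, *Modular forms and functions*, p. 237: equality of
newforms with almost all eigenvalues equal "has been shown by Atkin and Lehner").

This file discharges it: `theorem IsNewform0.eq_of_heckeEigenvalue_eq_holds`. The proof is the
assembly of three results already in the tree:

* `IsNewform0.eq_of_heckeEigenvalue_eq_of_facts` (`NewformsLevelRaising`): strong multiplicity
  one from (ML) the Atkin–Lehner Main Lemma `atkinLehnerMainLemma0 N k` (Atkin–Lehner 1970,
  Thm. 1) and (D) `disjoint_oldSubspace0_newSubspace0 N k` (Atkin–Lehner 1970, Thm. 5) — the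
  argument of Atkin–Lehner's Thm. 4: for newforms `f, g` with `λ_f(p) = λ_g(p)` off a finite set
  `A` of primes, the coefficients of `h = f - g` vanish at every `n` prime to `A` (recursion for
  `a_n` from the eigenvalues, `qExpansion_coeff_heckeT_holds`), then at every `n` prime to `N`
  (sieve `K_p` and the vanishing of `p`-supported forms for `p ∤ N`,
  `eq_zero_of_coeff_eq_zero_of_not_dvd_level0_holds`, level raising + Sturm), so `h` is old by
  (ML) and new by hypothesis, hence `0` by (D);
* `atkinLehnerMainLemma0_holds k N` (`NewformsMainLemmaTraceProofs`): (ML) proved, by traces and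
  the Atkin–Lehner matrices `W_p`;
* `disjoint_oldSubspace0_newSubspace0_holds N k` (`NewformsOldNewProofs`): (D) proved, by the
  two-level adjointness of the degeneracy maps for the Petersson product and its positivity.

## Main results (namespace `Literature.ModularForms`)

* `IsNewform0.eq_of_heckeEigenvalue_eq_holds : IsNewform0.eq_of_heckeEigenvalue_eq` — for every
  level `N ≥ 1` and weight `k : ℤ` (implicit, as in the fact); users holding
  `(h : IsNewform0.eq_of_heckeEigenvalue_eq (N := N) (k := k))` are fed this theorem.

## References

* A. O. L. Atkin, J. Lehner, *Hecke operators on `Γ₀(m)`*, Math. Ann. 185 (1970), 134–160,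
  Thm. 4 (with Thm. 1 and Thm. 5 as inputs).
* F. Diamond, J. Shurman, *A first course in modular forms*, GTM 228, Springer 2005, §5.7–§5.8
  (Thm. 5.7.1, Thm. 5.8.2; p. 219).
* R. A. Rankin, *Modular forms and functions*, Cambridge Univ. Press 1977, p. 237.
-/

noncomputable section

open scoped MatrixGroups ModularForm

open CongruenceSubgroup

namespace Literature.NumberTheory.EllipticCurves.ModularForms

variable {N : ℕ} [NeZero N] {k : ℤ}

/-- **Strong multiplicity one on `Γ₀(N)`, same level (Atkin–Lehner 1970, Thm. 4), proved**:
discharge of the named fact `IsNewform0.eq_of_heckeEigenvalue_eq` of `Newforms.lean` — two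
newforms in `S_k(Γ₀(N))` with the same Hecke eigenvalues at all but finitely many primes are
equal. Assembly of `IsNewform0.eq_of_heckeEigenvalue_eq_of_facts` (`NewformsLevelRaising`) with
the discharged inputs `atkinLehnerMainLemma0_holds` (Atkin–Lehner 1970, Thm. 1;
`NewformsMainLemmaTraceProofs`) and `disjoint_oldSubspace0_newSubspace0_holds` (Atkin–Lehner 1970,
Thm. 5; `NewformsOldNewProofs`). [cite: AtkinLehner1970, Thm. 4] -/
theorem IsNewform0.eq_of_heckeEigenvalue_eq_holds :
    IsNewform0.eq_of_heckeEigenvalue_eq (N := N) (k := k) :=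
  IsNewform0.eq_of_heckeEigenvalue_eq_of_facts (atkinLehnerMainLemma0_holds k N)
    (disjoint_oldSubspace0_newSubspace0_holds N k)

end Literature.NumberTheory.EllipticCurves.ModularForms
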